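import Literature.NumberTheory.LFunctions.KloostermanWeilPrimeProofs
import HarnessLib

/-!
# Tao–Teräväinen 2022, Lemma 3.8: Fourier coefficients on a hyperbola (from Weil's bound)

Topic `Literature/Barriers/Parity`, sub-namespace `TaoTeravainen`; a file of the proof DAG of
`Literature.Barriers.Parity.TaoTeravainen2021_prop72_81_pair` (T. Tao, J. Teräväinen, *The
Hardy–Littlewood–Chowla conjecture in the presence of a Siegel zero*, J. London Math. Soc. (2) 106
(2022), arXiv:2109.06291), §3.5 "Consequences of Kloosterman sum bounds". Everything here is
PROVED:

* a finite Fourier toolkit on `(ℤ/Qℤ)²` (`eQ`, `coeff2`: orthogonality, inversion, Parseval, the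
  vanishing of the coefficients of a function with a smaller period, and the resulting `ℓ¹` bound);
* `norm_hyperbolaAvg_unit_le` — (3.17): for `(w, Q) = (a, Q) = 1`,
  `|𝔼_{n₁,n₂ ∈ ℤ/Qℤ} 1_{w n₁ n₂ = a} e_Q(u₁n₁ + u₂n₂)| ≤ τ(Q) Q^{-3/2} (u₁,u₂,Q)^{1/2}`
  ("From [Estermann's form of the Weil bound] and a simple change of variables"), from the tree's
  PROVED Weil bound `Literature.NumberTheory.LFunctions.weil_kloosterman_bound_holds`
  (`|S(m,n;c)| ≤ (m,n,c)^{1/2} c^{1/2} τ(c)`, Iwaniec (2.25));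
* **`norm_hyperbolaCoeff_le`** — **Lemma 3.8**: for `q₀ ∣ Q`, `(a, Q) ∣ q₀` and a `1`-bounded
  `q₀`-periodic `f : (ℤ/Qℤ)² → ℂ`,
  `|𝔼_{n₁,n₂} f(n₁,n₂) 1_{n₁n₂ = a (Q)} e_Q(u₁n₁+u₂n₂)| ≤ τ(q₀)² q₀^{3/2} τ(Q) Q^{-3/2} (u₁,u₂,Q)^{1/2}`,
  following the printed proof (decomposition by `((n₁,q₀),(n₂,q₀)) = (q₁,q₂)`, the change of
  variables `nᵢ = qᵢ nᵢ'`, Fourier expansion of `f(q₁n₁', q₂n₂')` with Plancherel and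
  Cauchy–Schwarz, (3.17) for the modulus `Q' = Q/(a,Q)`, and `d ∣ q₀q₁q₂(u₁,u₂,Q)`).
  [cite: TaoTeravainen2021, Lemma 3.8 and (3.17)]

Here `(u₁,u₂,Q)` is `Nat.gcd (Nat.gcd u₁.val u₂.val) Q` for `uᵢ ∈ ℤ/Qℤ` (so `(0,0,Q) = Q`).
-/

noncomputable section

open Finset Complex
open Literature.NumberTheory.LFunctions (kloostermanSum weil_kloosterman_bound
  weil_kloosterman_bound_holds)

namespace Literature.Barriers.Parity

namespace TaoTeravainen

variable {Q : ℕ} [NeZero Q]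

/-! ### Finite Fourier analysis on `(ℤ/Qℤ)²` -/

/-- The additive character `e_Q(k₁m₁ + k₂m₂)` of `(ℤ/Qℤ)²`. [folklore] -/
def eQ (k m : ZMod Q × ZMod Q) : ℂ :=
  ZMod.stdAddChar (k.1 * m.1 + k.2 * m.2)

/-- `e_Q` has norm one. [folklore] -/
theorem norm_eQ (k m : ZMod Q × ZMod Q) : ‖eQ k m‖ = 1 := by
  unfold eQ
  rw [ZMod.stdAddChar_apply]
  exact Circle.norm_coe _

/-- `e_Q(k·(m + m')) = e_Q(k·m) e_Q(k·m')`. [folklore] -/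
theorem eQ_add_right (k m m' : ZMod Q × ZMod Q) : eQ k (m + m') = eQ k m * eQ k m' := by
  unfold eQ
  rw [← AddChar.map_add_eq_mul]
  congr 1
  simp only [Prod.fst_add, Prod.snd_add]
  ring

/-- `e_Q(k·(-m))` is the complex conjugate of `e_Q(k·m)`. [folklore] -/
theorem eQ_neg_right (k m : ZMod Q × ZMod Q) : eQ k (-m) = starRingEnd ℂ (eQ k m) := by
  unfold eQ
  rw [ZMod.stdAddChar_apply, ZMod.stdAddChar_apply, ← Circle.coe_inv_eq_conj, ← AddChar.map_neg_eq_inv]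
  congr 2
  simp only [Prod.fst_neg, Prod.snd_neg]
  ring

/-- `e_Q` is symmetric in its two arguments. [folklore] -/
theorem eQ_comm (k m : ZMod Q × ZMod Q) : eQ k m = eQ m k := by
  unfold eQ
  congr 1
  ring

/-- **Orthogonality**: `∑_{k ∈ (ℤ/Qℤ)²} e_Q(k·m) = Q² [m = 0]`. [folklore] -/
theorem sum_eQ (m : ZMod Q × ZMod Q) :
    ∑ k : ZMod Q × ZMod Q, eQ k m = if m = 0 then ((Q : ℂ) ^ 2) else 0 := by
  classical
  have h1 : ∀ b : ZMod Q, ∑ x : ZMod Q, (ZMod.stdAddChar (x * b) : ℂ) =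
      if b = 0 then (Q : ℂ) else 0 := by
    intro b
    rw [AddChar.sum_mulShift _ (ZMod.isPrimitive_stdAddChar Q), ZMod.card]
    split_ifs <;> simp
  calc ∑ k : ZMod Q × ZMod Q, eQ k m
      = ∑ k₁ : ZMod Q, ∑ k₂ : ZMod Q,
          (ZMod.stdAddChar (k₁ * m.1) : ℂ) * (ZMod.stdAddChar (k₂ * m.2) : ℂ) := by
        rw [Fintype.sum_prod_type]
        refine Finset.sum_congr rfl fun k₁ _ => Finset.sum_congr rfl fun k₂ _ => ?_
        unfold eQ
        rw [← AddChar.map_add_eq_mul]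
    _ = (∑ k₁ : ZMod Q, (ZMod.stdAddChar (k₁ * m.1) : ℂ)) *
          ∑ k₂ : ZMod Q, (ZMod.stdAddChar (k₂ * m.2) : ℂ) := by
        rw [Finset.sum_mul_sum]
    _ = if m = 0 then ((Q : ℂ) ^ 2) else 0 := by
        rw [h1, h1]
        rcases m with ⟨m₁, m₂⟩
        by_cases hm₁ : m₁ = 0 <;> by_cases hm₂ : m₂ = 0 <;> simp [hm₁, hm₂, sq]

/-- The Fourier coefficient `F̂(k) = Q⁻² ∑_m F(m) e_Q(-k·m)`. [folklore] -/
def coeff2 (F : ZMod Q × ZMod Q → ℂ) (k : ZMod Q × ZMod Q) : ℂ :=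
  (∑ m : ZMod Q × ZMod Q, F m * eQ k (-m)) / (Q : ℂ) ^ 2

/-- **Fourier inversion on `(ℤ/Qℤ)²`**: `F(m) = ∑_k F̂(k) e_Q(k·m)`. [folklore] -/
theorem sum_coeff2_mul_eQ (F : ZMod Q × ZMod Q → ℂ) (m : ZMod Q × ZMod Q) :
    ∑ k : ZMod Q × ZMod Q, coeff2 F k * eQ k m = F m := by
  classical
  have hQ : ((Q : ℂ) ^ 2) ≠ 0 := pow_ne_zero 2 (Nat.cast_ne_zero.mpr (NeZero.ne Q))
  calc ∑ k : ZMod Q × ZMod Q, coeff2 F k * eQ k m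
      = (∑ m' : ZMod Q × ZMod Q, F m' * ∑ k : ZMod Q × ZMod Q, eQ k (m - m')) / (Q : ℂ) ^ 2 := by
        unfold coeff2
        simp_rw [div_mul_eq_mul_div, ← Finset.sum_div, Finset.sum_mul]
        congr 1
        rw [Finset.sum_comm]
        simp_rw [Finset.mul_sum]
        refine Finset.sum_congr rfl fun m' _ => Finset.sum_congr rfl fun k _ => ?_
        rw [mul_assoc, ← eQ_add_right, show -m' + m = m - m' by abel]
    _ = (∑ m' : ZMod Q × ZMod Q, F m' * if m - m' = 0 then ((Q : ℂ) ^ 2) else 0) / (Q : ℂ) ^ 2 := by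
        simp_rw [sum_eQ]
    _ = F m := by
        simp_rw [sub_eq_zero, mul_ite, mul_zero]
        rw [Finset.sum_ite_eq Finset.univ m (fun m' => F m' * (Q : ℂ) ^ 2)]
        simp only [Finset.mem_univ, if_true]
        rw [mul_div_assoc, div_self hQ, mul_one]

/-- **Parseval on `(ℤ/Qℤ)²`**: `∑_k |F̂(k)|² = Q⁻² ∑_m |F(m)|²`. [folklore] -/
theorem sum_norm_coeff2_sq (F : ZMod Q × ZMod Q → ℂ) :
    ∑ k : ZMod Q × ZMod Q, ‖coeff2 F k‖ ^ 2 =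
      (∑ m : ZMod Q × ZMod Q, ‖F m‖ ^ 2) / (Q : ℝ) ^ 2 := by
  classical
  have hQ : ((Q : ℂ) ^ 2) ≠ 0 := pow_ne_zero 2 (Nat.cast_ne_zero.mpr (NeZero.ne Q))
  -- work in `ℂ`
  have key : ∀ k : ZMod Q × ZMod Q, ((‖coeff2 F k‖ ^ 2 : ℝ) : ℂ) =
      (∑ m : ZMod Q × ZMod Q, ∑ m' : ZMod Q × ZMod Q,
        F m * starRingEnd ℂ (F m') * eQ k (m' - m)) / (Q : ℂ) ^ 4 := by
    intro k
    rw [← Complex.normSq_eq_norm_sq, ← Complex.mul_conj]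
    unfold coeff2
    rw [map_div₀, map_pow, Complex.conj_natCast, map_sum, div_mul_div_comm, ← pow_add,
      Finset.sum_mul_sum]
    congr 1
    refine Finset.sum_congr rfl fun m _ => Finset.sum_congr rfl fun m' _ => ?_
    rw [map_mul, ← eQ_neg_right, neg_neg]
    calc F m * eQ k (-m) * (starRingEnd ℂ (F m') * eQ k m')
        = F m * starRingEnd ℂ (F m') * (eQ k (-m) * eQ k m') := by ring
      _ = F m * starRingEnd ℂ (F m') * eQ k (m' - m) := by
          rw [← eQ_add_right, show -m + m' = m' - m by abel]
  have hsum : ((∑ k : ZMod Q × ZMod Q, ‖coeff2 F k‖ ^ 2 : ℝ) : ℂ) =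
      ((∑ m : ZMod Q × ZMod Q, ‖F m‖ ^ 2) / (Q : ℝ) ^ 2 : ℝ) := by
    rw [Complex.ofReal_sum]
    simp_rw [key]
    rw [← Finset.sum_div, Complex.ofReal_div, Complex.ofReal_pow, Complex.ofReal_natCast,
      Complex.ofReal_sum]
    rw [Finset.sum_comm]
    have h2 : ∑ m : ZMod Q × ZMod Q, ∑ k : ZMod Q × ZMod Q, ∑ m' : ZMod Q × ZMod Q,
        F m * starRingEnd ℂ (F m') * eQ k (m' - m) =
        ∑ m : ZMod Q × ZMod Q, F m * starRingEnd ℂ (F m) * (Q : ℂ) ^ 2 := by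
      refine Finset.sum_congr rfl fun m _ => ?_
      rw [Finset.sum_comm]
      simp_rw [← Finset.mul_sum, sum_eQ, sub_eq_zero, mul_ite, mul_zero]
      rw [Finset.sum_ite_eq' Finset.univ m]
      simp
    rw [h2, ← Finset.sum_mul, mul_div_assoc]
    rw [show (Q : ℂ) ^ 2 / (Q : ℂ) ^ 4 = 1 / (Q : ℂ) ^ 2 by
      rw [div_eq_div_iff (pow_ne_zero 4 (Nat.cast_ne_zero.mpr (NeZero.ne Q))) hQ]; ring]
    rw [← mul_div_assoc, mul_one]
    congr 1
    refine Finset.sum_congr rfl fun m _ => ?_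
    rw [Complex.mul_conj, Complex.normSq_eq_norm_sq]
  exact_mod_cast hsum

/-- A shift-invariant function has Fourier coefficients supported on the annihilator of the
shift: if `F(m + P) = F(m)` for all `m` then `F̂(k) (e_Q(k·P) - 1) = 0`. [folklore] -/
theorem coeff2_mul_eQ_sub_one_of_periodic (F : ZMod Q × ZMod Q → ℂ) (P : ZMod Q × ZMod Q)
    (hF : ∀ m, F (m + P) = F m) (k : ZMod Q × ZMod Q) :
    coeff2 F k * (eQ k P - 1) = 0 := by
  classical
  rw [mul_sub, mul_one, sub_eq_zero]
  unfold coeff2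
  rw [div_mul_eq_mul_div]
  congr 1
  rw [Finset.sum_mul]
  -- reindex `m ↦ m - P`
  rw [← Equiv.sum_comp (Equiv.addRight (-P)) (fun m => F m * eQ k (-m))]
  refine Finset.sum_congr rfl fun m _ => ?_
  simp only [Equiv.coe_addRight]
  have h1 : F (m + -P) = F m := by
    have := hF (m + -P)
    rw [neg_add_cancel_right] at this
    exact this.symm
  rw [h1, mul_assoc, ← eQ_add_right]
  congr 2
  abel

/-- Hence `F̂(k) = 0` unless `e_Q(k·P) = 1`. [folklore] -/
theorem coeff2_eq_zero_of_periodic (F : ZMod Q × ZMod Q → ℂ) (P : ZMod Q × ZMod Q)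
    (hF : ∀ m, F (m + P) = F m) {k : ZMod Q × ZMod Q} (hk : eQ k P ≠ 1) : coeff2 F k = 0 := by
  have h := coeff2_mul_eQ_sub_one_of_periodic F P hF k
  rcases mul_eq_zero.mp h with h | h
  · exact h
  · exact absurd (sub_eq_zero.mp h) hk

/-- `e_Q(x) = 1` iff `x = 0` (primitivity of the standard character). [folklore] -/
theorem stdAddChar_eq_one_iff {x : ZMod Q} : (ZMod.stdAddChar x : ℂ) = 1 ↔ x = 0 := by
  constructor
  · intro h
    exact ZMod.injective_stdAddChar (h.trans (AddChar.map_zero_eq_one _).symm)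
  · rintro rfl
    exact AddChar.map_zero_eq_one _


/-- `e_Q((k₁,k₂)·(N,0)) = 1` iff `k₁ N = 0`, and then `k₁` is a multiple of `Q/N` (for `N ∣ Q`):
precisely `k₁ = (Q/N)·j` with `j = k₁.val/(Q/N) < N`. [folklore] -/
theorem eq_cast_mul_of_mul_eq_zero {N : ℕ} (hN : N ∣ Q) {k : ZMod Q} (hk : k * (N : ZMod Q) = 0) :
    k.val / (Q / N) < N ∧ (((Q / N) * (k.val / (Q / N)) : ℕ) : ZMod Q) = k := by
  obtain ⟨M, hM⟩ := hN
  have hQ0 : 0 < Q := Nat.pos_of_ne_zero (NeZero.ne Q)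
  have hN0 : 0 < N := Nat.pos_of_ne_zero (by rintro rfl; simp at hM; exact (NeZero.ne Q) hM)
  have hM0 : 0 < M := Nat.pos_of_ne_zero (by rintro rfl; simp at hM; exact (NeZero.ne Q) hM)
  have hQN : Q / N = M := by rw [hM, Nat.mul_div_cancel_left _ hN0]
  -- `Q ∣ k.val * N`, hence `M ∣ k.val`
  have hdvd : Q ∣ k.val * N := by
    rw [← ZMod.natCast_eq_zero_iff]
    push_cast
    rw [ZMod.natCast_zmod_val]
    exact hk
  have hMk : M ∣ k.val := by
    have h2 : N * M ∣ N * k.val := by rw [← hM, mul_comm N k.val]; exact hdvd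
    exact Nat.dvd_of_mul_dvd_mul_left hN0 h2
  obtain ⟨j, hj⟩ := hMk
  rw [hQN, hj, Nat.mul_div_cancel_left _ hM0]
  refine ⟨?_, ?_⟩
  · have hlt : k.val < Q := ZMod.val_lt k
    rw [hj, hM, mul_comm N M] at hlt
    exact Nat.lt_of_mul_lt_mul_left hlt
  · rw [← hj, ZMod.natCast_zmod_val]

/-- **`ℓ¹` bound for the Fourier coefficients of a `1`-bounded function with periods `(N₁,0)`
and `(0,N₂)`** (`N₁, N₂ ∣ Q`): `∑_k |F̂(k)| ≤ √(N₁N₂)` (the coefficients vanish off the `N₁N₂`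
frequencies `((Q/N₁)j₁, (Q/N₂)j₂)`, and Cauchy–Schwarz with Parseval).
[cite: TaoTeravainen2021, proof of Lemma 3.8 ("By Fourier inversion and the Plancherel formula …
and hence by Cauchy–Schwarz")] -/
theorem sum_norm_coeff2_le {F : ZMod Q × ZMod Q → ℂ} (hF1 : ∀ m, ‖F m‖ ≤ 1) {N₁ N₂ : ℕ}
    (hN₁ : N₁ ∣ Q) (hN₂ : N₂ ∣ Q) (hP₁ : ∀ m, F (m + ((N₁ : ZMod Q), 0)) = F m)
    (hP₂ : ∀ m, F (m + (0, (N₂ : ZMod Q))) = F m) :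
    ∑ k : ZMod Q × ZMod Q, ‖coeff2 F k‖ ≤ Real.sqrt ((N₁ : ℝ) * N₂) := by
  classical
  -- the support of the coefficients
  set S : Finset (ZMod Q × ZMod Q) :=
    Finset.univ.filter fun k => k.1 * (N₁ : ZMod Q) = 0 ∧ k.2 * (N₂ : ZMod Q) = 0 with hS
  have hsupp : ∀ k : ZMod Q × ZMod Q, k ∉ S → coeff2 F k = 0 := by
    intro k hk
    rw [hS, Finset.mem_filter, not_and_or] at hk
    rcases hk with hk | hk
    · exact absurd (Finset.mem_univ k) hk
    rcases not_and_or.mp hk with hk | hk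
    · refine coeff2_eq_zero_of_periodic F ((N₁ : ZMod Q), 0) hP₁ ?_
      unfold eQ
      simp only [mul_zero, add_zero]
      rwa [Ne, stdAddChar_eq_one_iff]
    · refine coeff2_eq_zero_of_periodic F (0, (N₂ : ZMod Q)) hP₂ ?_
      unfold eQ
      simp only [mul_zero, zero_add]
      rwa [Ne, stdAddChar_eq_one_iff]
  -- the support has at most `N₁ N₂` elements
  have hcard : (S.card : ℝ) ≤ (N₁ : ℝ) * N₂ := by
    have hsub : S ⊆ (Finset.range N₁ ×ˢ Finset.range N₂).image
        fun j => ((((Q / N₁) * j.1 : ℕ) : ZMod Q), (((Q / N₂) * j.2 : ℕ) : ZMod Q)) := by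
      intro k hk
      rw [hS, Finset.mem_filter] at hk
      obtain ⟨h1, h1'⟩ := eq_cast_mul_of_mul_eq_zero hN₁ hk.2.1
      obtain ⟨h2, h2'⟩ := eq_cast_mul_of_mul_eq_zero hN₂ hk.2.2
      rw [Finset.mem_image]
      refine ⟨(k.1.val / (Q / N₁), k.2.val / (Q / N₂)), ?_, ?_⟩
      · rw [Finset.mem_product, Finset.mem_range, Finset.mem_range]
        exact ⟨h1, h2⟩
      · simp only [h1', h2']
    calc (S.card : ℝ) ≤ ((Finset.range N₁ ×ˢ Finset.range N₂).image
          fun j => ((((Q / N₁) * j.1 : ℕ) : ZMod Q), (((Q / N₂) * j.2 : ℕ) : ZMod Q))).card := by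
          exact_mod_cast Finset.card_le_card hsub
      _ ≤ ((Finset.range N₁ ×ˢ Finset.range N₂).card : ℝ) := by
          exact_mod_cast Finset.card_image_le
      _ = (N₁ : ℝ) * N₂ := by
          rw [Finset.card_product, Finset.card_range, Finset.card_range, Nat.cast_mul]
  -- Parseval: `∑_{k ∈ S} |F̂ k|² ≤ 1`
  have hpar : ∑ k ∈ S, ‖coeff2 F k‖ ^ 2 ≤ 1 := by
    have hQ : (0 : ℝ) < (Q : ℝ) ^ 2 := by
      have : (0 : ℝ) < Q := by exact_mod_cast Nat.pos_of_ne_zero (NeZero.ne Q)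
      positivity
    calc ∑ k ∈ S, ‖coeff2 F k‖ ^ 2 ≤ ∑ k : ZMod Q × ZMod Q, ‖coeff2 F k‖ ^ 2 :=
          Finset.sum_le_sum_of_subset_of_nonneg (Finset.subset_univ _) fun _ _ _ => sq_nonneg _
      _ = (∑ m : ZMod Q × ZMod Q, ‖F m‖ ^ 2) / (Q : ℝ) ^ 2 := sum_norm_coeff2_sq F
      _ ≤ (∑ _m : ZMod Q × ZMod Q, (1 : ℝ)) / (Q : ℝ) ^ 2 := by
          gcongr with m
          have h := hF1 m
          have h0 := norm_nonneg (F m)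
          nlinarith
      _ = 1 := by
          rw [Finset.sum_const, Finset.card_univ, Fintype.card_prod, ZMod.card, nsmul_eq_mul,
            mul_one, Nat.cast_mul, ← sq, div_self hQ.ne']
  -- Cauchy–Schwarz
  have hCS : (∑ k ∈ S, ‖coeff2 F k‖) ^ 2 ≤ (S.card : ℝ) * ∑ k ∈ S, ‖coeff2 F k‖ ^ 2 := by
    have h := Finset.sum_mul_sq_le_sq_mul_sq S (fun _ => (1 : ℝ)) (fun k => ‖coeff2 F k‖)
    simp only [one_mul, one_pow, Finset.sum_const, nsmul_eq_mul, mul_one] at h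
    exact h
  have hsumS : ∑ k : ZMod Q × ZMod Q, ‖coeff2 F k‖ = ∑ k ∈ S, ‖coeff2 F k‖ := by
    symm
    refine Finset.sum_subset (Finset.subset_univ _) fun k _ hk => ?_
    rw [hsupp k hk, norm_zero]
  rw [hsumS]
  have h0 : 0 ≤ ∑ k ∈ S, ‖coeff2 F k‖ := Finset.sum_nonneg fun _ _ => norm_nonneg _
  rw [← Real.sqrt_sq h0]
  refine Real.sqrt_le_sqrt ?_
  calc (∑ k ∈ S, ‖coeff2 F k‖) ^ 2 ≤ (S.card : ℝ) * ∑ k ∈ S, ‖coeff2 F k‖ ^ 2 := hCS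
    _ ≤ (N₁ : ℝ) * N₂ * 1 := by gcongr
    _ = (N₁ : ℝ) * N₂ := mul_one _

/-! ### (3.17): the coprime case via a complete Kloosterman sum -/

omit [NeZero Q] in
/-- `(c x, Q) ∣ …`: multiplying by any `c` can only add common factors:
`gcd(x.val, Q) ∣ gcd((c x).val, Q)`. [folklore] -/
theorem gcd_val_dvd_gcd_val_mul (c x : ZMod Q) :
    Nat.gcd x.val Q ∣ Nat.gcd (c * x).val Q := by
  refine Nat.dvd_gcd ?_ (Nat.gcd_dvd_right _ _)
  have h1 : Nat.gcd x.val Q ∣ c.val * x.val := dvd_mul_of_dvd_right (Nat.gcd_dvd_left _ _) _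
  have h2 : Nat.gcd x.val Q ∣ Q := Nat.gcd_dvd_right _ _
  rw [ZMod.val_mul]
  exact (Nat.dvd_mod_iff h2).mpr h1

omit [NeZero Q] in
/-- Multiplication by a unit preserves `gcd(·, Q)`: `gcd((c x).val, Q) = gcd(x.val, Q)`.
[folklore] -/
theorem gcd_val_mul_unit (x : ZMod Q) {c : ZMod Q} (hc : IsUnit c) :
    Nat.gcd (c * x).val Q = Nat.gcd x.val Q := by
  refine Nat.dvd_antisymm ?_ (gcd_val_dvd_gcd_val_mul c x)
  have h := gcd_val_dvd_gcd_val_mul c⁻¹ (c * x)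
  rwa [← mul_assoc, ZMod.inv_mul_of_unit c hc, one_mul] at h

/-- On the hyperbola `w n₁ n₂ = a` with `w, a` units, `n₁` is a unit and `n₂ = a w⁻¹ n₁⁻¹`:
the inner sum over `n₂`. [folklore] -/
theorem sum_ite_hyperbola_eq {w a : ZMod Q} (hw : IsUnit w) (ha : IsUnit a) (G : ZMod Q → ℂ)
    (n₁ : ZMod Q) :
    (∑ n₂ : ZMod Q, if w * n₁ * n₂ = a then G n₂ else 0) =
      if IsUnit n₁ then G (a * w⁻¹ * n₁⁻¹) else 0 := by
  classical
  by_cases hn : IsUnit n₁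
  · rw [if_pos hn]
    have heq : ∀ n₂ : ZMod Q, w * n₁ * n₂ = a ↔ n₂ = a * w⁻¹ * n₁⁻¹ := by
      intro n₂
      constructor
      · intro h
        calc n₂ = (w⁻¹ * w) * (n₁⁻¹ * n₁) * n₂ := by
              rw [ZMod.inv_mul_of_unit w hw, ZMod.inv_mul_of_unit n₁ hn, one_mul, one_mul]
          _ = w⁻¹ * n₁⁻¹ * (w * n₁ * n₂) := by ring
          _ = a * w⁻¹ * n₁⁻¹ := by rw [h]; ring
      · rintro rfl
        calc w * n₁ * (a * w⁻¹ * n₁⁻¹) = a * (w * w⁻¹) * (n₁ * n₁⁻¹) := by ring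
          _ = a := by rw [ZMod.mul_inv_of_unit w hw, ZMod.mul_inv_of_unit n₁ hn, mul_one, mul_one]
    simp_rw [heq]
    rw [Finset.sum_ite_eq' Finset.univ (a * w⁻¹ * n₁⁻¹)]
    simp
  · rw [if_neg hn]
    refine Finset.sum_eq_zero fun n₂ _ => ?_
    rw [if_neg]
    intro h
    apply hn
    have : IsUnit (w * n₁ * n₂) := by rw [h]; exact ha
    exact isUnit_of_mul_isUnit_right (isUnit_of_mul_isUnit_left this)


/-- The normalised hyperbola sum `𝔼_{n₁,n₂ ∈ ℤ/Qℤ} 1_{w n₁ n₂ = a} e_Q(u₁n₁ + u₂n₂)`.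
[cite: TaoTeravainen2021, (3.17)] -/
def hyperbolaAvg (w a : ZMod Q) (u : ZMod Q × ZMod Q) : ℂ :=
  (∑ n : ZMod Q × ZMod Q, if w * n.1 * n.2 = a then eQ u n else 0) / (Q : ℂ) ^ 2

/-- **The change of variables**: for units `w, a` the hyperbola sum is the complete Kloosterman sum
`S(u₁, u₂ a w⁻¹; Q) = ∑_{x ∈ (ℤ/Qℤ)ˣ} e_Q(u₁ x + u₂ a w⁻¹ x⁻¹)`.
[cite: TaoTeravainen2021, (3.17) ("From this and a simple change of variables")] -/
theorem hyperbolaSum_eq_kloostermanSum {w a : ZMod Q} (hw : IsUnit w) (ha : IsUnit a)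
    (u : ZMod Q × ZMod Q) :
    (∑ n : ZMod Q × ZMod Q, if w * n.1 * n.2 = a then eQ u n else 0) =
      kloostermanSum Q u.1 (u.2 * (a * w⁻¹)) := by
  classical
  rw [Fintype.sum_prod_type]
  unfold kloostermanSum
  refine Finset.sum_congr rfl fun n₁ _ => ?_
  rw [sum_ite_hyperbola_eq hw ha (fun n₂ => eQ u (n₁, n₂)) n₁]
  by_cases hn : IsUnit n₁
  · rw [if_pos hn, if_pos hn]
    unfold eQ
    congr 1
    simp only
    ring
  · rw [if_neg hn, if_neg hn]

/-- **(3.17)**: for `(w, Q) = (a, Q) = 1`,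
`|𝔼_{n₁,n₂ ∈ ℤ/Qℤ} 1_{w n₁ n₂ = a} e_Q(u₁n₁ + u₂n₂)| ≤ τ(Q) Q^{-3/2} (u₁,u₂,Q)^{1/2}`, from
Weil's bound `|S(m,n;Q)| ≤ (m,n,Q)^{1/2} Q^{1/2} τ(Q)` (the tree's `weil_kloosterman_bound_holds`)
and `(u₁, u₂ a w⁻¹, Q) = (u₁, u₂, Q)`. [cite: TaoTeravainen2021, (3.17)] -/
theorem norm_hyperbolaAvg_le {w a : ZMod Q} (hw : IsUnit w) (ha : IsUnit a)
    (u : ZMod Q × ZMod Q) :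
    ‖hyperbolaAvg w a u‖ ≤ (Nat.divisors Q).card *
      Real.sqrt (Nat.gcd (Nat.gcd u.1.val u.2.val) Q) / ((Q : ℝ) * Real.sqrt Q) := by
  have hQ0 : (0 : ℝ) < Q := by exact_mod_cast Nat.pos_of_ne_zero (NeZero.ne Q)
  unfold hyperbolaAvg
  rw [hyperbolaSum_eq_kloostermanSum hw ha u, norm_div, norm_pow, Complex.norm_natCast]
  set b : ZMod Q := u.2 * (a * w⁻¹) with hb
  -- Weil's bound for `S(u₁, b; Q)`
  have hW := weil_kloosterman_bound_holds Q (u.1.val : ℤ) (b.val : ℤ)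
  have hc1 : (((u.1.val : ℤ) : ZMod Q)) = u.1 := by push_cast; exact ZMod.natCast_zmod_val _
  have hc2 : (((b.val : ℤ) : ZMod Q)) = b := by push_cast; exact ZMod.natCast_zmod_val _
  rw [hc1, hc2, Int.natAbs_natCast, Int.natAbs_natCast] at hW
  -- the gcd is unchanged by the unit `a w⁻¹`
  have hunit : IsUnit (a * w⁻¹) := by
    refine ha.mul ?_
    exact IsUnit.of_mul_eq_one w (ZMod.inv_mul_of_unit w hw)
  have hgcd : Nat.gcd (Nat.gcd u.1.val b.val) Q = Nat.gcd (Nat.gcd u.1.val u.2.val) Q := by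
    rw [Nat.gcd_assoc, Nat.gcd_assoc, hb, mul_comm, gcd_val_mul_unit u.2 hunit]
  rw [hgcd] at hW
  rw [div_le_div_iff₀ (by positivity) (by positivity)]
  calc ‖kloostermanSum Q u.1 b‖ * ((Q : ℝ) * Real.sqrt Q)
      ≤ Real.sqrt (Nat.gcd (Nat.gcd u.1.val u.2.val) Q) * Real.sqrt Q * (Nat.divisors Q).card *
          ((Q : ℝ) * Real.sqrt Q) := by gcongr
    _ = (Nat.divisors Q).card * Real.sqrt (Nat.gcd (Nat.gcd u.1.val u.2.val) Q) * (Q : ℝ) ^ 2 := by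
        have hsq : Real.sqrt Q * Real.sqrt Q = Q := Real.mul_self_sqrt hQ0.le
        calc Real.sqrt (Nat.gcd (Nat.gcd u.1.val u.2.val) Q) * Real.sqrt Q * (Nat.divisors Q).card *
              ((Q : ℝ) * Real.sqrt Q)
            = (Nat.divisors Q).card * Real.sqrt (Nat.gcd (Nat.gcd u.1.val u.2.val) Q) *
                ((Q : ℝ) * (Real.sqrt Q * Real.sqrt Q)) := by ring
          _ = _ := by rw [hsq, sq]


/-! ### Summation helpers on `ℤ/Qℤ` -/

omit [NeZero Q] in
/-- Splitting `range (P c)` into `c` blocks of length `P`: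
`∑_{j < P c} F(j) = ∑_{s < c} ∑_{r < P} F(r + P s)`. [folklore] -/
theorem sum_range_mul_eq_sum_sum {M : Type*} [AddCommMonoid M] (F : ℕ → M) (P c : ℕ) :
    ∑ j ∈ Finset.range (P * c), F j = ∑ s ∈ Finset.range c, ∑ r ∈ Finset.range P, F (r + P * s) := by
  induction c with
  | zero => simp
  | succ c ih =>
    rw [Nat.mul_succ, Finset.sum_range_add, ih, Finset.sum_range_succ]
    congr 1
    refine Finset.sum_congr rfl fun r _ => ?_
    rw [add_comm]

/-- A sum over `ℤ/Qℤ` is the sum over the representatives `0, …, Q-1`. [folklore] -/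
theorem sum_univ_zmod_eq_sum_range {M : Type*} [AddCommMonoid M] (G : ZMod Q → M) :
    ∑ x : ZMod Q, G x = ∑ n ∈ Finset.range Q, G n :=
  Literature.NumberTheory.LFunctions.sum_zmod_eq_sum_range G

/-- **Sums over multiples**: if `K : ℤ/Qℤ → ℂ` vanishes off the multiples of `q₁ ∣ Q`, then
`∑_n K(n) = q₁⁻¹ ∑_m K(q₁ m)` (each multiple of `q₁` is hit `q₁` times by `m ↦ q₁ m`).
[folklore] -/
theorem sum_eq_sum_mul_div {q₁ : ℕ} (hq₁ : q₁ ∣ Q) (K : ZMod Q → ℂ)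
    (hK : ∀ n : ZMod Q, ¬ q₁ ∣ n.val → K n = 0) :
    ∑ n : ZMod Q, K n = (∑ m : ZMod Q, K ((q₁ : ZMod Q) * m)) / q₁ := by
  classical
  obtain ⟨P, hP⟩ := hq₁
  have hq0 : q₁ ≠ 0 := by rintro rfl; rw [zero_mul] at hP; exact (NeZero.ne Q) hP
  have hq0' : (q₁ : ℂ) ≠ 0 := Nat.cast_ne_zero.mpr hq0
  rw [eq_div_iff hq0']
  -- the right-hand side over representatives, split into `q₁` blocks of length `P`
  have hrange : Finset.range Q = Finset.range (q₁ * P) := congrArg Finset.range hP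
  have hrange' : Finset.range Q = Finset.range (P * q₁) := by rw [hrange, mul_comm]
  rw [sum_univ_zmod_eq_sum_range (fun x => K ((q₁ : ZMod Q) * x)), hrange',
    sum_range_mul_eq_sum_sum]
  have hper : ∀ s r : ℕ, K ((q₁ : ZMod Q) * ((r + P * s : ℕ) : ZMod Q)) =
      K ((q₁ : ZMod Q) * (r : ZMod Q)) := by
    intro s r
    congr 1
    push_cast
    have hQ : ((q₁ : ZMod Q) * (P : ZMod Q)) = 0 := by
      rw [← Nat.cast_mul, ← hP, ZMod.natCast_self]
    calc (q₁ : ZMod Q) * ((r : ZMod Q) + (P : ZMod Q) * (s : ZMod Q))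
        = (q₁ : ZMod Q) * (r : ZMod Q) + (q₁ : ZMod Q) * (P : ZMod Q) * (s : ZMod Q) := by ring
      _ = (q₁ : ZMod Q) * (r : ZMod Q) := by rw [hQ, zero_mul, add_zero]
  rw [Finset.sum_congr rfl fun s _ => Finset.sum_congr rfl fun r _ => hper s r]
  rw [Finset.sum_const, Finset.card_range, nsmul_eq_mul, mul_comm]
  congr 1
  -- the left-hand side: only multiples `q₁ r`, `r < P`, contribute
  rw [sum_univ_zmod_eq_sum_range K, hrange]
  symm
  have hcast : ∀ r : ℕ, K ((q₁ : ZMod Q) * (r : ZMod Q)) =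
      (fun n : ℕ => K (n : ZMod Q)) ((fun r : ℕ => q₁ * r) r) := by
    intro r
    simp only [Nat.cast_mul]
  rw [Finset.sum_congr rfl fun r _ => hcast r,
    ← Finset.sum_image (f := fun n : ℕ => K (n : ZMod Q)) (s := Finset.range P)
      (g := fun r : ℕ => q₁ * r)]
  · refine (Finset.sum_subset ?_ ?_)
    · intro n hn
      rw [Finset.mem_image] at hn
      obtain ⟨r, hr, rfl⟩ := hn
      rw [Finset.mem_range] at hr ⊢
      exact Nat.mul_lt_mul_of_pos_left hr (Nat.pos_of_ne_zero hq0)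
    · intro n hn hnot
      apply hK
      rw [Finset.mem_range] at hn
      rw [ZMod.val_cast_of_lt (by rw [hP]; exact hn)]
      rintro ⟨r, rfl⟩
      apply hnot
      rw [Finset.mem_image]
      refine ⟨r, ?_, rfl⟩
      rw [Finset.mem_range]
      exact Nat.lt_of_mul_lt_mul_left hn
  · intro r hr r' hr' h
    exact Nat.eq_of_mul_eq_mul_left (Nat.pos_of_ne_zero hq0) h


/-! ### The hyperbola sum for a non-coprime right-hand side -/

/-- A geometric sum of a character value of order dividing `g`:
`∑_{s < g} e_Q(c s) = g [c = 0]` when `g c = 0`. [folklore] -/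
theorem sum_range_stdAddChar_mul {g : ℕ} {c : ZMod Q} (hc : (g : ZMod Q) * c = 0) :
    ∑ s ∈ Finset.range g, (ZMod.stdAddChar (c * (s : ZMod Q)) : ℂ) =
      if c = 0 then (g : ℂ) else 0 := by
  by_cases h0 : c = 0
  · rw [if_pos h0, h0]
    simp
  rw [if_neg h0]
  have hpow : ∀ s : ℕ, (ZMod.stdAddChar (c * (s : ZMod Q)) : ℂ) = (ZMod.stdAddChar c : ℂ) ^ s := by
    intro s
    rw [← AddChar.map_nsmul_eq_pow, nsmul_eq_mul, mul_comm]
  simp_rw [hpow]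
  have hne : (ZMod.stdAddChar c : ℂ) ≠ 1 := fun h => h0 (stdAddChar_eq_one_iff.mp h)
  rw [geom_sum_eq hne]
  have hg : (ZMod.stdAddChar c : ℂ) ^ g = 1 := by
    rw [← hpow, mul_comm, hc, AddChar.map_zero_eq_one]
  rw [hg, sub_self, zero_div]

omit [NeZero Q] in
/-- `τ(Q') ≤ τ(Q)` for `Q' ∣ Q ≠ 0`. [folklore] -/
theorem card_divisors_le_of_dvd {Q' : ℕ} (h : Q' ∣ Q) (hQ : Q ≠ 0) :
    (Nat.divisors Q').card ≤ (Nat.divisors Q).card :=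
  Finset.card_le_card (Nat.divisors_subset_of_dvd hQ h)

/-- A sum over `(ℤ/Qℤ)²` as a double sum over representatives. [folklore] -/
theorem sum_univ_prod_zmod_eq {M : Type*} [AddCommMonoid M] (F : ZMod Q × ZMod Q → M) :
    ∑ m : ZMod Q × ZMod Q, F m =
      ∑ j₁ ∈ Finset.range Q, ∑ j₂ ∈ Finset.range Q, F ((j₁ : ZMod Q), (j₂ : ZMod Q)) := by
  rw [Fintype.sum_prod_type, sum_univ_zmod_eq_sum_range]
  refine Finset.sum_congr rfl fun j₁ _ => ?_
  exact sum_univ_zmod_eq_sum_range _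

/-- **The hyperbola sum with `(a, Q) = g`**: for `W` with `(W, Q) = (a, Q) = g` and any
frequencies `A₁, A₂ ∈ ℤ/Qℤ`,
`|∑_{m₁,m₂ ∈ ℤ/Qℤ} 1_{W m₁ m₂ = a} e_Q(A₁m₁ + A₂m₂)| ≤ g τ(Q) √Q √((A₁,A₂,Q))`
(splitting `mᵢ = rᵢ + (Q/g) sᵢ`: the `sᵢ`-sums vanish unless `g ∣ Aᵢ`, and then the `rᵢ`-sum is
`Q'²` times the coprime hyperbola sum (3.17) modulo `Q' = Q/g` with `w = W/g`, `a' = a/g`).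
[cite: TaoTeravainen2021, proof of Lemma 3.8 ("Since `1_{w n'₁ n'₂ = a/(a,q) (q')}` is a
`q'`-periodic function … this expression vanishes unless … divisible by `q/q' = (a,q)` … we may
then apply (3.17)")] -/
theorem norm_hyperbolaSum_le {W : ℕ} {a : ZMod Q} (hW : Nat.gcd W Q = Nat.gcd a.val Q)
    (A : ZMod Q × ZMod Q) :
    ‖∑ m : ZMod Q × ZMod Q, (if (W : ZMod Q) * m.1 * m.2 = a then eQ A m else 0)‖ ≤
      (Nat.gcd a.val Q : ℝ) * (Nat.divisors Q).card * Real.sqrt Q *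
        Real.sqrt (Nat.gcd (Nat.gcd A.1.val A.2.val) Q) := by
  classical
  -- notation
  have hQ0 : Q ≠ 0 := NeZero.ne Q
  have hQpos : 0 < Q := Nat.pos_of_ne_zero hQ0
  obtain ⟨g, hg⟩ : ∃ g : ℕ, g = Nat.gcd a.val Q := ⟨_, rfl⟩
  rw [← hg] at hW ⊢
  have hg0 : 0 < g := by rw [hg]; exact Nat.gcd_pos_of_pos_right _ hQpos
  have hgQ : g ∣ Q := by rw [hg]; exact Nat.gcd_dvd_right _ _
  have hga : g ∣ a.val := by rw [hg]; exact Nat.gcd_dvd_left _ _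
  have hgW : g ∣ W := by rw [← hW]; exact Nat.gcd_dvd_left _ _
  obtain ⟨Q', hQ'⟩ := hgQ
  obtain ⟨a', ha'⟩ := hga
  obtain ⟨W', hW'⟩ := hgW
  have hQ'0 : Q' ≠ 0 := by rintro rfl; rw [mul_zero] at hQ'; exact hQ0 hQ'
  haveI : NeZero Q' := ⟨hQ'0⟩
  have hQ'pos : 0 < Q' := Nat.pos_of_ne_zero hQ'0
  -- coprimality of `W'`, `a'` with `Q'`
  have hcopW : Nat.Coprime W' Q' := by
    have h := Nat.coprime_div_gcd_div_gcd (m := W) (n := Q) (by rw [hW]; exact hg0)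
    rw [hW, hW', hQ', Nat.mul_div_cancel_left _ hg0, Nat.mul_div_cancel_left _ hg0] at h
    exact h
  have hcopa : Nat.Coprime a' Q' := by
    have h := Nat.coprime_div_gcd_div_gcd (m := a.val) (n := Q) (by rw [← hg]; exact hg0)
    rw [← hg, ha', hQ', Nat.mul_div_cancel_left _ hg0, Nat.mul_div_cancel_left _ hg0] at h
    exact h
  have hunitW : IsUnit ((W' : ℕ) : ZMod Q') := (ZMod.isUnit_iff_coprime W' Q').mpr hcopW
  have hunita : IsUnit ((a' : ℕ) : ZMod Q') := (ZMod.isUnit_iff_coprime a' Q').mpr hcopa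
  -- Step 1: pass to representatives and split `jᵢ = rᵢ + Q' sᵢ`
  obtain ⟨Φ, hΦ⟩ : ∃ Φ : ℕ → ℕ → ℂ, Φ = fun (j₁ j₂ : ℕ) =>
    if ((W : ZMod Q) * (j₁ : ZMod Q) * (j₂ : ZMod Q)) = a then eQ A ((j₁ : ZMod Q), (j₂ : ZMod Q))
      else 0 := ⟨_, rfl⟩
  have hΦapp : ∀ x y : ℕ, Φ x y =
      if ((W : ZMod Q) * (x : ZMod Q) * (y : ZMod Q)) = a then eQ A ((x : ZMod Q), (y : ZMod Q))
      else 0 := fun x y => by simp only [hΦ]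
  have hstep1 : ∑ m : ZMod Q × ZMod Q, (if (W : ZMod Q) * m.1 * m.2 = a then eQ A m else 0) =
      ∑ s₁ ∈ Finset.range g, ∑ s₂ ∈ Finset.range g, ∑ r₁ ∈ Finset.range Q', ∑ r₂ ∈ Finset.range Q',
        Φ (r₁ + Q' * s₁) (r₂ + Q' * s₂) := by
    have hrange : Finset.range Q = Finset.range (Q' * g) := by rw [hQ', mul_comm]
    rw [sum_univ_prod_zmod_eq]
    simp only [← hΦapp]
    rw [hrange]
    simp only [sum_range_mul_eq_sum_sum]
    refine Finset.sum_congr rfl fun s₁ _ => ?_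
    exact Finset.sum_comm
  -- Step 2: the summand factors: the congruence only sees `rᵢ`, the phase splits
  have hWQ' : ((W : ZMod Q) * (Q' : ZMod Q)) = 0 := by
    rw [hW', Nat.cast_mul, mul_assoc, mul_comm (W' : ZMod Q), ← mul_assoc, ← Nat.cast_mul, ← hQ',
      ZMod.natCast_self, zero_mul]
  obtain ⟨c₁, hc₁⟩ : ∃ c : ZMod Q, c = A.1 * (Q' : ZMod Q) := ⟨_, rfl⟩
  obtain ⟨c₂, hc₂⟩ : ∃ c : ZMod Q, c = A.2 * (Q' : ZMod Q) := ⟨_, rfl⟩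
  have hfactor : ∀ s₁ s₂ r₁ r₂ : ℕ, Φ (r₁ + Q' * s₁) (r₂ + Q' * s₂) =
      Φ r₁ r₂ * (ZMod.stdAddChar (c₁ * (s₁ : ZMod Q)) : ℂ) * (ZMod.stdAddChar (c₂ * (s₂ : ZMod Q)) : ℂ) := by
    intro s₁ s₂ r₁ r₂
    have hcong : (W : ZMod Q) * ((r₁ + Q' * s₁ : ℕ) : ZMod Q) * ((r₂ + Q' * s₂ : ℕ) : ZMod Q) =
        (W : ZMod Q) * (r₁ : ZMod Q) * (r₂ : ZMod Q) := by
      push_cast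
      calc (W : ZMod Q) * ((r₁ : ZMod Q) + (Q' : ZMod Q) * (s₁ : ZMod Q)) *
            ((r₂ : ZMod Q) + (Q' : ZMod Q) * (s₂ : ZMod Q))
          = (W : ZMod Q) * (r₁ : ZMod Q) * (r₂ : ZMod Q) +
              (W : ZMod Q) * (Q' : ZMod Q) * ((s₁ : ZMod Q) * (r₂ : ZMod Q) +
                (r₁ : ZMod Q) * (s₂ : ZMod Q) + (Q' : ZMod Q) * (s₁ : ZMod Q) * (s₂ : ZMod Q)) := by
            ring
        _ = (W : ZMod Q) * (r₁ : ZMod Q) * (r₂ : ZMod Q) := by rw [hWQ', zero_mul, add_zero]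
    rw [hΦapp, hΦapp, hcong]
    split_ifs with h
    · unfold eQ
      rw [← AddChar.map_add_eq_mul, ← AddChar.map_add_eq_mul]
      congr 1
      push_cast
      rw [hc₁, hc₂]
      ring
    · rw [zero_mul, zero_mul]
  have hgc₁ : (g : ZMod Q) * c₁ = 0 := by
    rw [hc₁, mul_comm, mul_assoc, ← Nat.cast_mul, mul_comm Q' g, ← hQ', ZMod.natCast_self,
      mul_zero]
  have hgc₂ : (g : ZMod Q) * c₂ = 0 := by
    rw [hc₂, mul_comm, mul_assoc, ← Nat.cast_mul, mul_comm Q' g, ← hQ', ZMod.natCast_self,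
      mul_zero]
  have hstep2 : ∑ m : ZMod Q × ZMod Q, (if (W : ZMod Q) * m.1 * m.2 = a then eQ A m else 0) =
      (∑ r₁ ∈ Finset.range Q', ∑ r₂ ∈ Finset.range Q', Φ r₁ r₂) *
        ((if c₁ = 0 then (g : ℂ) else 0) * (if c₂ = 0 then (g : ℂ) else 0)) := by
    rw [hstep1, ← sum_range_stdAddChar_mul hgc₁, ← sum_range_stdAddChar_mul hgc₂,
      Finset.sum_mul_sum, Finset.mul_sum]
    refine Finset.sum_congr rfl fun s₁ _ => ?_
    rw [Finset.mul_sum]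
    refine Finset.sum_congr rfl fun s₂ _ => ?_
    rw [Finset.sum_mul]
    refine Finset.sum_congr rfl fun r₁ _ => ?_
    rw [Finset.sum_mul]
    refine Finset.sum_congr rfl fun r₂ _ => ?_
    rw [hfactor]
    ring
  -- Step 3: if `g ∤ A₁` or `g ∤ A₂` the sum vanishes
  by_cases hdiv : c₁ = 0 ∧ c₂ = 0
  swap
  · rw [hstep2]
    have : (if c₁ = 0 then (g : ℂ) else 0) * (if c₂ = 0 then (g : ℂ) else 0) = 0 := by
      rcases not_and_or.mp hdiv with h | h
      · rw [if_neg h, zero_mul]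
      · rw [if_neg h, mul_zero]
    rw [this, mul_zero, norm_zero]
    refine mul_nonneg (mul_nonneg (mul_nonneg (Nat.cast_nonneg _) (Nat.cast_nonneg _))
      (Real.sqrt_nonneg _)) (Real.sqrt_nonneg _)
  obtain ⟨h1, h2⟩ := hdiv
  rw [hstep2, if_pos h1, if_pos h2]
  -- `g ∣ Aᵢ.val`
  have hdvdA : ∀ {Ai : ZMod Q}, Ai * (Q' : ZMod Q) = 0 → g ∣ Ai.val := by
    intro Ai h
    have hQdvd : Q ∣ Ai.val * Q' := by
      rw [← ZMod.natCast_eq_zero_iff]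
      push_cast
      rw [ZMod.natCast_zmod_val]
      exact h
    have h3 : g * Q' ∣ Ai.val * Q' := by rw [← hQ']; exact hQdvd
    exact Nat.dvd_of_mul_dvd_mul_right hQ'pos h3
  obtain ⟨B₁, hB₁⟩ := hdvdA (show A.1 * (Q' : ZMod Q) = 0 by rw [← hc₁]; exact h1)
  obtain ⟨B₂, hB₂⟩ := hdvdA (show A.2 * (Q' : ZMod Q) = 0 by rw [← hc₂]; exact h2)
  have hB₁lt : B₁ < Q' := by
    have := ZMod.val_lt A.1
    rw [hB₁, hQ'] at this
    exact Nat.lt_of_mul_lt_mul_left this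
  have hB₂lt : B₂ < Q' := by
    have := ZMod.val_lt A.2
    rw [hB₂, hQ'] at this
    exact Nat.lt_of_mul_lt_mul_left this
  -- Step 4: the `r`-sum is `Q'²` times the coprime hyperbola average modulo `Q'`
  have hcond : ∀ r₁ r₂ : ℕ, ((W : ZMod Q) * (r₁ : ZMod Q) * (r₂ : ZMod Q) = a) ↔
      ((W' : ZMod Q') * (r₁ : ZMod Q') * (r₂ : ZMod Q') = (a' : ZMod Q')) := by
    intro r₁ r₂
    have e1 : (W : ZMod Q) * (r₁ : ZMod Q) * (r₂ : ZMod Q) = ((W * r₁ * r₂ : ℕ) : ZMod Q) := by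
      push_cast; ring
    have e2 : (W' : ZMod Q') * (r₁ : ZMod Q') * (r₂ : ZMod Q') = ((W' * r₁ * r₂ : ℕ) : ZMod Q') := by
      push_cast; ring
    have e3 : a = ((a.val : ℕ) : ZMod Q) := (ZMod.natCast_zmod_val a).symm
    rw [e1, e2, e3, ZMod.natCast_eq_natCast_iff, ZMod.natCast_eq_natCast_iff, ha', hW', hQ',
      mul_assoc g W', mul_assoc g (W' * r₁)]
    constructor
    · intro h
      exact Nat.ModEq.mul_left_cancel' hg0.ne' h
    · intro h
      exact Nat.ModEq.mul_left' g h
  have hphase : ∀ r₁ r₂ : ℕ, eQ A ((r₁ : ZMod Q), (r₂ : ZMod Q)) =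
      eQ ((B₁ : ZMod Q'), (B₂ : ZMod Q')) ((r₁ : ZMod Q'), (r₂ : ZMod Q')) := by
    intro r₁ r₂
    unfold eQ
    simp only
    have eA1 : A.1 = ((A.1.val : ℕ) : ZMod Q) := (ZMod.natCast_zmod_val A.1).symm
    have eA2 : A.2 = ((A.2.val : ℕ) : ZMod Q) := (ZMod.natCast_zmod_val A.2).symm
    rw [eA1, eA2, hB₁, hB₂]
    have e1 : ((g * B₁ : ℕ) : ZMod Q) * (r₁ : ZMod Q) + ((g * B₂ : ℕ) : ZMod Q) * (r₂ : ZMod Q) =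
        (((g * (B₁ * r₁ + B₂ * r₂) : ℕ) : ℤ) : ZMod Q) := by push_cast; ring
    have e2 : (B₁ : ZMod Q') * (r₁ : ZMod Q') + (B₂ : ZMod Q') * (r₂ : ZMod Q') =
        ((((B₁ * r₁ + B₂ * r₂) : ℕ) : ℤ) : ZMod Q') := by push_cast; ring
    rw [e1, e2, ZMod.stdAddChar_coe, ZMod.stdAddChar_coe]
    congr 1
    have hQc : (Q : ℂ) = (g : ℂ) * (Q' : ℂ) := by rw [hQ']; push_cast; ring
    have hg0' : (g : ℂ) ≠ 0 := Nat.cast_ne_zero.mpr hg0.ne'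
    have hQ'c : (Q' : ℂ) ≠ 0 := Nat.cast_ne_zero.mpr hQ'0
    rw [hQc]
    push_cast
    field_simp
  have hstep4 : ∑ r₁ ∈ Finset.range Q', ∑ r₂ ∈ Finset.range Q', Φ r₁ r₂ =
      (Q' : ℂ) ^ 2 * hyperbolaAvg ((W' : ℕ) : ZMod Q') ((a' : ℕ) : ZMod Q')
        ((B₁ : ZMod Q'), (B₂ : ZMod Q')) := by
    unfold hyperbolaAvg
    rw [mul_div_cancel₀ _ (pow_ne_zero 2 (Nat.cast_ne_zero.mpr hQ'0)), sum_univ_prod_zmod_eq]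
    refine Finset.sum_congr rfl fun r₁ _ => Finset.sum_congr rfl fun r₂ _ => ?_
    rw [hΦapp, hphase r₁ r₂]
    simp only
    by_cases h : (W : ZMod Q) * (r₁ : ZMod Q) * (r₂ : ZMod Q) = a
    · rw [if_pos h, if_pos ((hcond r₁ r₂).mp h)]
    · rw [if_neg h, if_neg (fun h' => h ((hcond r₁ r₂).mpr h'))]
  rw [hstep4]
  -- Step 5: the bound
  have h317 := norm_hyperbolaAvg_le hunitW hunita ((B₁ : ZMod Q'), (B₂ : ZMod Q'))
  simp only at h317
  rw [ZMod.val_cast_of_lt hB₁lt, ZMod.val_cast_of_lt hB₂lt] at h317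
  have hgcdB : Nat.gcd (Nat.gcd B₁ B₂) Q' * g = Nat.gcd (Nat.gcd A.1.val A.2.val) Q := by
    rw [hB₁, hB₂, hQ', Nat.gcd_mul_left, Nat.gcd_mul_left, mul_comm]
  have hgcdB' : ((Nat.gcd (Nat.gcd A.1.val A.2.val) Q : ℕ) : ℝ) =
      ((Nat.gcd (Nat.gcd B₁ B₂) Q' : ℕ) : ℝ) * (g : ℝ) := by
    exact_mod_cast hgcdB.symm
  have hτ : ((Nat.divisors Q').card : ℝ) ≤ ((Nat.divisors Q).card : ℝ) := by
    exact_mod_cast card_divisors_le_of_dvd (Q := Q) ⟨g, by rw [hQ', mul_comm]⟩ hQ0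
  have hQ'R : (0 : ℝ) < Q' := by exact_mod_cast hQ'pos
  have hgR : (0 : ℝ) < g := by exact_mod_cast hg0
  have hQR : (Q : ℝ) = g * Q' := by rw [hQ']; push_cast; ring
  rw [norm_mul, norm_mul, norm_pow, Complex.norm_natCast, norm_mul, Complex.norm_natCast]
  obtain ⟨σ, hσ⟩ : ∃ σ : ℝ, σ = Real.sqrt (g : ℝ) := ⟨_, rfl⟩
  obtain ⟨t, ht⟩ : ∃ t : ℝ, t = Real.sqrt (Q' : ℝ) := ⟨_, rfl⟩
  have hσσ : σ * σ = g := by rw [hσ]; exact Real.mul_self_sqrt hgR.le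
  have htt : t * t = Q' := by rw [ht]; exact Real.mul_self_sqrt hQ'R.le
  have ht0 : 0 < t := by rw [ht]; exact Real.sqrt_pos.mpr hQ'R
  have hσ0 : 0 < σ := by rw [hσ]; exact Real.sqrt_pos.mpr hgR
  have hsqQ : Real.sqrt (Q : ℝ) = σ * t := by rw [hQR, Real.sqrt_mul hgR.le, hσ, ht]
  obtain ⟨dd, hdd⟩ : ∃ dd : ℝ, dd = Real.sqrt ((Nat.gcd (Nat.gcd B₁ B₂) Q' : ℕ) : ℝ) := ⟨_, rfl⟩
  have hd : Real.sqrt ((Nat.gcd (Nat.gcd A.1.val A.2.val) Q : ℕ) : ℝ) = dd * σ := by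
    rw [hgcdB', Real.sqrt_mul (Nat.cast_nonneg _), hdd, hσ]
  rw [hsqQ, hd]
  rw [← ht, ← hdd] at h317
  have hdd0 : 0 ≤ dd := by rw [hdd]; exact Real.sqrt_nonneg _
  have havg : ‖hyperbolaAvg ((W' : ℕ) : ZMod Q') ((a' : ℕ) : ZMod Q') ((B₁ : ZMod Q'), (B₂ : ZMod Q'))‖
      ≤ ((Nat.divisors Q').card : ℝ) * dd / ((Q' : ℝ) * t) := h317
  clear h317 hstep4 hphase hcond hstep1 hstep2 hfactor hΦapp hΦ
  calc (Q' : ℝ) ^ 2 * ‖hyperbolaAvg ((W' : ℕ) : ZMod Q') ((a' : ℕ) : ZMod Q')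
          ((B₁ : ZMod Q'), (B₂ : ZMod Q'))‖ * ((g : ℝ) * g)
      ≤ (Q' : ℝ) ^ 2 * (((Nat.divisors Q').card : ℝ) * dd / ((Q' : ℝ) * t)) * ((g : ℝ) * g) := by
        gcongr
    _ = (t * t) ^ 2 * (((Nat.divisors Q').card : ℝ) * dd / ((t * t) * t)) * ((σ * σ) * (σ * σ)) := by
        rw [htt, hσσ]
    _ = ((t * t) ^ 2 / ((t * t) * t)) * ((Nat.divisors Q').card : ℝ) * dd * ((σ * σ) * (σ * σ)) := by
        rw [mul_div_assoc', mul_div_assoc, mul_div_assoc]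
        ring
    _ = σ ^ 4 * ((Nat.divisors Q').card : ℝ) * dd * t := by
        have h3 : (t * t) ^ 2 / ((t * t) * t) = t := by
          rw [div_eq_iff (mul_ne_zero (mul_ne_zero ht0.ne' ht0.ne') ht0.ne')]
          ring
        rw [h3]
        ring
    _ ≤ σ ^ 4 * ((Nat.divisors Q).card : ℝ) * dd * t := by gcongr
    _ = (σ * σ) * ((Nat.divisors Q).card : ℝ) * (σ * t) * (dd * σ) := by ring
    _ = (g : ℝ) * ((Nat.divisors Q).card : ℝ) * (σ * t) * (dd * σ) := by rw [hσσ]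


/-! ### Lemma 3.8: arithmetic of the decomposition by `((n₁,q₀),(n₂,q₀))` -/

omit [NeZero Q] in
/-- `gcd(gcd(x,Q) gcd(y,Q), Q) = gcd(xy, Q)` ("from considering the prime factorisations").
[cite: TaoTeravainen2021, proof of Lemma 3.8] -/
theorem gcd_gcd_mul_gcd (x y : ℕ) (hQ : Q ≠ 0) :
    Nat.gcd (Nat.gcd x Q * Nat.gcd y Q) Q = Nat.gcd (x * y) Q := by
  rcases Nat.eq_zero_or_pos x with rfl | hx
  · simp [Nat.gcd_zero_left]
  rcases Nat.eq_zero_or_pos y with rfl | hy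
  · simp [Nat.gcd_zero_left]
  have h1 : Nat.gcd x Q ≠ 0 := (Nat.gcd_pos_of_pos_right _ (Nat.pos_of_ne_zero hQ)).ne'
  have h2 : Nat.gcd y Q ≠ 0 := (Nat.gcd_pos_of_pos_right _ (Nat.pos_of_ne_zero hQ)).ne'
  have hL : Nat.gcd (Nat.gcd x Q * Nat.gcd y Q) Q ≠ 0 :=
    (Nat.gcd_pos_of_pos_right _ (Nat.pos_of_ne_zero hQ)).ne'
  have hR : Nat.gcd (x * y) Q ≠ 0 := (Nat.gcd_pos_of_pos_right _ (Nat.pos_of_ne_zero hQ)).ne'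
  refine Nat.eq_of_factorization_eq hL hR fun p => ?_
  rw [Nat.factorization_gcd (mul_ne_zero h1 h2) hQ, Nat.factorization_gcd (mul_ne_zero hx.ne' hy.ne') hQ,
    Nat.factorization_mul h1 h2, Nat.factorization_mul hx.ne' hy.ne',
    Nat.factorization_gcd hx.ne' hQ, Nat.factorization_gcd hy.ne' hQ]
  simp only [Finsupp.inf_apply, Finsupp.add_apply]
  omega

/-- **Non-empty classes**: if `n₁ n₂ = a` in `ℤ/Qℤ`, `q₀ ∣ Q` and `(a,Q) ∣ q₀`, then
`((n₁,q₀)(n₂,q₀), Q) = (a, Q)` ("`(n₁,q₀), (n₂,q₀)` must be factors of `(a,q)` and hence of `q₀`;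
also `((n₁,q₀)(n₂,q₀), q) = (a,q₀) = (a,q)`"). [cite: TaoTeravainen2021, proof of Lemma 3.8] -/
theorem gcd_class_mul_eq {q₀ : ℕ} (hq₀ : q₀ ∣ Q) {a n₁ n₂ : ZMod Q} (ha : Nat.gcd a.val Q ∣ q₀)
    (h : n₁ * n₂ = a) :
    Nat.gcd (Nat.gcd n₁.val q₀ * Nat.gcd n₂.val q₀) Q = Nat.gcd a.val Q := by
  have hQ0 : Q ≠ 0 := NeZero.ne Q
  -- `(a, Q) = (n₁.val n₂.val, Q)`
  have hprod : Nat.gcd a.val Q = Nat.gcd (n₁.val * n₂.val) Q := by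
    rw [← h, ZMod.val_mul, ← Nat.gcd_rec, Nat.gcd_comm]
  -- `(nᵢ, q₀) = (nᵢ, Q)`
  have hi : ∀ {m : ℕ}, Nat.gcd m Q ∣ Nat.gcd a.val Q → Nat.gcd m q₀ = Nat.gcd m Q := by
    intro m hm
    refine Nat.dvd_antisymm ?_ ?_
    · exact Nat.dvd_gcd (Nat.gcd_dvd_left _ _) ((Nat.gcd_dvd_right _ _).trans hq₀)
    · exact Nat.dvd_gcd (Nat.gcd_dvd_left _ _) (hm.trans ha)
  have h1 : Nat.gcd n₁.val Q ∣ Nat.gcd a.val Q := by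
    rw [hprod]
    exact Nat.gcd_dvd_gcd_mul_right_left _ _ _
  have h2 : Nat.gcd n₂.val Q ∣ Nat.gcd a.val Q := by
    rw [hprod]
    exact Nat.gcd_dvd_gcd_mul_left_left _ _ _
  rw [hi h1, hi h2, hprod]
  exact gcd_gcd_mul_gcd _ _ hQ0


/-- **`d ∣ q₀ q₁ q₂ (u₁,u₂,Q)`**: for frequencies `kᵢ` annihilated by `Nᵢ = q₀/qᵢ` (the support of
the Fourier coefficients of a `(N₁,N₂)`-periodic function), the common divisor
`d = ((k₁ + q₁u₁), (k₂ + q₂u₂), Q)` divides `q₀q₁q₂(u₁,u₂,Q)` ("by taking suitable linear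
combinations `u₁q₀q₁q₂ = u₂q₀q₁q₂ = q q₀q₁q₂ = 0 (d)`").
[cite: TaoTeravainen2021, proof of Lemma 3.8] -/
theorem gcd_freq_dvd {q₀ q₁ q₂ N₁ N₂ : ℕ} (hN₁ : q₁ * N₁ = q₀) (hN₂ : q₂ * N₂ = q₀)
    {k u : ZMod Q × ZMod Q} (hk₁ : k.1 * (N₁ : ZMod Q) = 0) (hk₂ : k.2 * (N₂ : ZMod Q) = 0) :
    Nat.gcd (Nat.gcd (k.1 + (q₁ : ZMod Q) * u.1).val (k.2 + (q₂ : ZMod Q) * u.2).val) Q ∣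
      q₀ * q₁ * q₂ * Nat.gcd (Nat.gcd u.1.val u.2.val) Q := by
  set d : ℕ := Nat.gcd (Nat.gcd (k.1 + (q₁ : ZMod Q) * u.1).val (k.2 + (q₂ : ZMod Q) * u.2).val) Q
    with hd
  have hdQ : d ∣ Q := Nat.gcd_dvd_right _ _
  have hdA₁ : d ∣ (k.1 + (q₁ : ZMod Q) * u.1).val :=
    (Nat.gcd_dvd_left _ _).trans (Nat.gcd_dvd_left _ _)
  have hdA₂ : d ∣ (k.2 + (q₂ : ZMod Q) * u.2).val :=
    (Nat.gcd_dvd_left _ _).trans (Nat.gcd_dvd_right _ _)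
  -- `q₀ Aᵢ = q₀ qᵢ uᵢ` in `ℤ/Qℤ`
  have key : ∀ {qi Ni : ℕ} {ki ui : ZMod Q}, qi * Ni = q₀ → ki * (Ni : ZMod Q) = 0 →
      d ∣ (ki + (qi : ZMod Q) * ui).val → d ∣ q₀ * qi * ui.val := by
    intro qi Ni ki ui hNi hki hdAi
    have hZ : ((q₀ * (ki + (qi : ZMod Q) * ui).val : ℕ) : ZMod Q) =
        ((q₀ * qi * ui.val : ℕ) : ZMod Q) := by
      push_cast
      rw [ZMod.natCast_zmod_val, ZMod.natCast_zmod_val, mul_add, ← hNi, Nat.cast_mul,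
        mul_comm (qi : ZMod Q) (Ni : ZMod Q), mul_assoc, mul_comm (Ni : ZMod Q), ← mul_assoc,
        mul_assoc (qi : ZMod Q), hki, mul_zero, zero_add]
    have hmod := (ZMod.natCast_eq_natCast_iff _ _ _).mp hZ
    exact (hmod.dvd_iff hdQ).mp (dvd_mul_of_dvd_right hdAi _)
  have h1 : d ∣ q₀ * q₁ * q₂ * u.1.val := by
    have := key hN₁ hk₁ hdA₁
    rw [mul_assoc (q₀ * q₁), mul_comm q₂, ← mul_assoc]
    exact dvd_mul_of_dvd_left this _
  have h2 : d ∣ q₀ * q₁ * q₂ * u.2.val := by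
    have := key hN₂ hk₂ hdA₂
    rw [mul_assoc q₀ q₁ q₂, mul_comm q₁ q₂, ← mul_assoc, mul_assoc (q₀ * q₂), mul_comm q₁,
      ← mul_assoc]
    exact dvd_mul_of_dvd_left this _
  have h3 : d ∣ q₀ * q₁ * q₂ * Q := dvd_mul_of_dvd_right hdQ _
  have := Nat.dvd_gcd (Nat.dvd_gcd h1 h2) h3
  rwa [Nat.gcd_mul_left, Nat.gcd_mul_left] at this

/-- `e_Q((k + k')·m) = e_Q(k·m) e_Q(k'·m)`. [folklore] -/
theorem eQ_add_left (k k' m : ZMod Q × ZMod Q) : eQ (k + k') m = eQ k m * eQ k' m := by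
  rw [eQ_comm, eQ_add_right, eQ_comm m k, eQ_comm m k']

/-- Dilating the variables moves the dilation onto the frequencies:
`e_Q(u·(q₁m₁, q₂m₂)) = e_Q((q₁u₁, q₂u₂)·m)`. [folklore] -/
theorem eQ_dilate (u m : ZMod Q × ZMod Q) (q₁ q₂ : ℕ) :
    eQ u (((q₁ : ZMod Q) * m.1), ((q₂ : ZMod Q) * m.2)) =
      eQ (((q₁ : ZMod Q) * u.1), ((q₂ : ZMod Q) * u.2)) m := by
  unfold eQ
  congr 1
  simp only
  ring


/-! ### Lemma 3.8 -/

/-- The hyperbola Fourier coefficient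
`𝔼_{n₁,n₂ ∈ ℤ/Qℤ} f(n₁,n₂) 1_{n₁ n₂ = a} e_Q(u₁n₁ + u₂n₂)`. [cite: TaoTeravainen2021, Lemma 3.8] -/
def hyperbolaCoeff (f : ZMod Q × ZMod Q → ℂ) (a : ZMod Q) (u : ZMod Q × ZMod Q) : ℂ :=
  (∑ n : ZMod Q × ZMod Q, if n.1 * n.2 = a then f n * eQ u n else 0) / (Q : ℂ) ^ 2

/-- **One class `((n₁,q₀),(n₂,q₀)) = (q₁,q₂)`** (the bound (3.18) of the source): if the
`1`-bounded `q₀`-periodic `f` is supported where `(n₁,q₀) = q₁`, `(n₂,q₀) = q₂`, then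
`|∑_{n₁n₂ = a} f(n) e_Q(u·n)| ≤ q₀^{3/2} τ(Q) Q^{1/2} (u₁,u₂,Q)^{1/2}`.
[cite: TaoTeravainen2021, proof of Lemma 3.8, (3.18)] -/
theorem norm_hyperbolaSum_class_le {q₀ : ℕ} (hq₀ : q₀ ∣ Q) {a : ZMod Q}
    (ha : Nat.gcd a.val Q ∣ q₀) {q₁ q₂ : ℕ} (hq₁ : q₁ ∣ q₀) (hq₂ : q₂ ∣ q₀)
    {f : ZMod Q × ZMod Q → ℂ} (hf1 : ∀ n, ‖f n‖ ≤ 1)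
    (hfp₁ : ∀ n, f (n + ((q₀ : ZMod Q), 0)) = f n) (hfp₂ : ∀ n, f (n + (0, (q₀ : ZMod Q))) = f n)
    (hsupp : ∀ n, f n ≠ 0 → Nat.gcd n.1.val q₀ = q₁ ∧ Nat.gcd n.2.val q₀ = q₂)
    (u : ZMod Q × ZMod Q) :
    ‖∑ n : ZMod Q × ZMod Q, (if n.1 * n.2 = a then f n * eQ u n else 0)‖ ≤
      (q₀ : ℝ) * Real.sqrt q₀ * (Nat.divisors Q).card * Real.sqrt Q *
        Real.sqrt (Nat.gcd (Nat.gcd u.1.val u.2.val) Q) := by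
  classical
  have hQ0 : Q ≠ 0 := NeZero.ne Q
  have hQpos : 0 < Q := Nat.pos_of_ne_zero hQ0
  have hq₀0 : q₀ ≠ 0 := by rintro rfl; exact hQ0 (zero_dvd_iff.mp hq₀)
  have hq₁0 : q₁ ≠ 0 := by rintro rfl; exact hq₀0 (zero_dvd_iff.mp hq₁)
  have hq₂0 : q₂ ≠ 0 := by rintro rfl; exact hq₀0 (zero_dvd_iff.mp hq₂)
  obtain ⟨N₁, hN₁⟩ := hq₁
  obtain ⟨N₂, hN₂⟩ := hq₂
  have hnonneg : 0 ≤ (q₀ : ℝ) * Real.sqrt q₀ * (Nat.divisors Q).card * Real.sqrt Q *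
      Real.sqrt (Nat.gcd (Nat.gcd u.1.val u.2.val) Q) :=
    mul_nonneg (mul_nonneg (mul_nonneg (mul_nonneg (Nat.cast_nonneg _) (Real.sqrt_nonneg _))
      (Nat.cast_nonneg _)) (Real.sqrt_nonneg _)) (Real.sqrt_nonneg _)
  -- Case A: the class does not meet the hyperbola
  by_cases hcase : Nat.gcd (q₁ * q₂) Q = Nat.gcd a.val Q
  swap
  · have h0 : ∑ n : ZMod Q × ZMod Q, (if n.1 * n.2 = a then f n * eQ u n else 0) = 0 := by
      refine Finset.sum_eq_zero fun n _ => ?_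
      split_ifs with h
      · by_cases hf : f n = 0
        · rw [hf, zero_mul]
        · exfalso
          obtain ⟨h1, h2⟩ := hsupp n hf
          apply hcase
          rw [← h1, ← h2]
          exact gcd_class_mul_eq hq₀ ha h
      · rfl
    rw [h0, norm_zero]
    exact hnonneg
  -- Case B.  Step 1: restrict both variables to multiples of `q₁`, `q₂`
  have hq₁Q : q₁ ∣ Q := (Dvd.intro _ hN₁.symm).trans hq₀
  have hq₂Q : q₂ ∣ Q := (Dvd.intro _ hN₂.symm).trans hq₀
  obtain ⟨G, hG⟩ : ∃ G : ZMod Q × ZMod Q → ℂ,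
      G = fun m => f (((q₁ : ZMod Q) * m.1), ((q₂ : ZMod Q) * m.2)) := ⟨_, rfl⟩
  set u' : ZMod Q × ZMod Q := (((q₁ : ZMod Q) * u.1), ((q₂ : ZMod Q) * u.2)) with hu'
  have hstep1 : ∑ n : ZMod Q × ZMod Q, (if n.1 * n.2 = a then f n * eQ u n else 0) =
      (∑ m : ZMod Q × ZMod Q,
        (if ((q₁ * q₂ : ℕ) : ZMod Q) * m.1 * m.2 = a then G m * eQ u' m else 0)) / ((q₁ : ℂ) * q₂) := by
    rw [Fintype.sum_prod_type, Fintype.sum_prod_type]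
    -- outer variable
    rw [sum_eq_sum_mul_div hq₁Q (fun n₁ => ∑ n₂ : ZMod Q, if n₁ * n₂ = a then f (n₁, n₂) * eQ u (n₁, n₂) else 0)]
    swap
    · intro n₁ hn₁
      refine Finset.sum_eq_zero fun n₂ _ => ?_
      split_ifs with h
      · by_cases hf : f (n₁, n₂) = 0
        · rw [hf, zero_mul]
        · exact absurd ((hsupp _ hf).1 ▸ Nat.gcd_dvd_left n₁.val q₀) hn₁
      · rfl
    have inner : ∀ m₁ : ZMod Q,
        (∑ n₂ : ZMod Q, if (q₁ : ZMod Q) * m₁ * n₂ = a then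
          f (((q₁ : ZMod Q) * m₁), n₂) * eQ u (((q₁ : ZMod Q) * m₁), n₂) else 0) =
        (∑ m₂ : ZMod Q, if ((q₁ * q₂ : ℕ) : ZMod Q) * m₁ * m₂ = a then
          G (m₁, m₂) * eQ u' (m₁, m₂) else 0) / (q₂ : ℂ) := by
      intro m₁
      rw [sum_eq_sum_mul_div hq₂Q (fun n₂ => if (q₁ : ZMod Q) * m₁ * n₂ = a then
        f (((q₁ : ZMod Q) * m₁), n₂) * eQ u (((q₁ : ZMod Q) * m₁), n₂) else 0)]
      swap
      · intro n₂ hn₂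
        split_ifs with h
        · by_cases hf : f (((q₁ : ZMod Q) * m₁), n₂) = 0
          · rw [hf, zero_mul]
          · exact absurd ((hsupp _ hf).2 ▸ Nat.gcd_dvd_left n₂.val q₀) hn₂
        · rfl
      congr 1
      refine Finset.sum_congr rfl fun m₂ _ => ?_
      have hW : ((q₁ * q₂ : ℕ) : ZMod Q) * m₁ * m₂ = (q₁ : ZMod Q) * m₁ * ((q₂ : ZMod Q) * m₂) := by
        push_cast; ring
      have hd := eQ_dilate u (m₁, m₂) q₁ q₂
      have hGm : G (m₁, m₂) = f (((q₁ : ZMod Q) * m₁), ((q₂ : ZMod Q) * m₂)) := by rw [hG]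
      simp only at hd
      rw [hW, hd, hGm]
    simp only [inner]
    rw [← Finset.sum_div, div_div, mul_comm (q₂ : ℂ)]
  -- Step 2: Fourier expansion of `G`
  have hG1 : ∀ m, ‖G m‖ ≤ 1 := fun m => by rw [hG]; exact hf1 _
  have hN₁Q : N₁ ∣ Q := (Dvd.intro_left _ hN₁.symm).trans hq₀
  have hN₂Q : N₂ ∣ Q := (Dvd.intro_left _ hN₂.symm).trans hq₀
  have hq₁N₁ : ((q₁ : ZMod Q) * (N₁ : ZMod Q)) = (q₀ : ZMod Q) := by rw [← Nat.cast_mul, ← hN₁]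
  have hq₂N₂ : ((q₂ : ZMod Q) * (N₂ : ZMod Q)) = (q₀ : ZMod Q) := by rw [← Nat.cast_mul, ← hN₂]
  have hGp₁ : ∀ m, G (m + ((N₁ : ZMod Q), 0)) = G m := by
    intro m
    rw [hG]
    simp only [Prod.fst_add, Prod.snd_add, add_zero]
    rw [mul_add, hq₁N₁]
    have := hfp₁ (((q₁ : ZMod Q) * m.1), ((q₂ : ZMod Q) * m.2))
    simpa using this
  have hGp₂ : ∀ m, G (m + (0, (N₂ : ZMod Q))) = G m := by
    intro m
    rw [hG]
    simp only [Prod.fst_add, Prod.snd_add, add_zero]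
    rw [mul_add, hq₂N₂]
    have := hfp₂ (((q₁ : ZMod Q) * m.1), ((q₂ : ZMod Q) * m.2))
    simpa using this
  have hstep2 : ∑ m : ZMod Q × ZMod Q,
      (if ((q₁ * q₂ : ℕ) : ZMod Q) * m.1 * m.2 = a then G m * eQ u' m else 0) =
      ∑ k : ZMod Q × ZMod Q, coeff2 G k *
        ∑ m : ZMod Q × ZMod Q, (if ((q₁ * q₂ : ℕ) : ZMod Q) * m.1 * m.2 = a then eQ (k + u') m else 0) := by
    simp_rw [Finset.mul_sum]
    rw [Finset.sum_comm]
    refine Finset.sum_congr rfl fun m _ => ?_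
    by_cases h : ((q₁ * q₂ : ℕ) : ZMod Q) * m.1 * m.2 = a
    · simp only [if_pos h]
      rw [← sum_coeff2_mul_eQ G m, Finset.sum_mul]
      refine Finset.sum_congr rfl fun k _ => ?_
      rw [eQ_add_left]
      ring
    · simp only [if_neg h, mul_zero, Finset.sum_const_zero]
  -- Step 3: the bound for each frequency `k` in the support of `Ĝ`
  obtain ⟨D, hD⟩ : ∃ D : ℕ, D = q₀ * q₁ * q₂ * Nat.gcd (Nat.gcd u.1.val u.2.val) Q := ⟨_, rfl⟩
  have hDpos : 0 < D := by
    rw [hD]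
    exact Nat.mul_pos (Nat.mul_pos (Nat.mul_pos (Nat.pos_of_ne_zero hq₀0) (Nat.pos_of_ne_zero hq₁0))
      (Nat.pos_of_ne_zero hq₂0)) (Nat.gcd_pos_of_pos_right _ hQpos)
  obtain ⟨g, hg⟩ : ∃ g : ℕ, g = Nat.gcd a.val Q := ⟨_, rfl⟩
  have hW : Nat.gcd (q₁ * q₂) Q = Nat.gcd a.val Q := hcase
  have hgle : (g : ℝ) ≤ (q₁ : ℝ) * q₂ := by
    have : g ≤ q₁ * q₂ := by
      rw [hg, ← hW]
      exact Nat.gcd_le_left _ (Nat.mul_pos (Nat.pos_of_ne_zero hq₁0) (Nat.pos_of_ne_zero hq₂0))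
    exact_mod_cast this
  set B : ℝ := (g : ℝ) * (Nat.divisors Q).card * Real.sqrt Q * Real.sqrt D with hB
  have hk : ∀ k : ZMod Q × ZMod Q,
      ‖coeff2 G k * ∑ m : ZMod Q × ZMod Q,
        (if ((q₁ * q₂ : ℕ) : ZMod Q) * m.1 * m.2 = a then eQ (k + u') m else 0)‖ ≤
        ‖coeff2 G k‖ * B := by
    intro k
    by_cases hGk : coeff2 G k = 0
    · rw [hGk, zero_mul, norm_zero, zero_mul]
    have hk₁ : k.1 * (N₁ : ZMod Q) = 0 := by
      by_contra hne
      apply hGk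
      refine coeff2_eq_zero_of_periodic G ((N₁ : ZMod Q), 0) hGp₁ ?_
      unfold eQ
      simp only [mul_zero, add_zero]
      rwa [Ne, stdAddChar_eq_one_iff]
    have hk₂ : k.2 * (N₂ : ZMod Q) = 0 := by
      by_contra hne
      apply hGk
      refine coeff2_eq_zero_of_periodic G (0, (N₂ : ZMod Q)) hGp₂ ?_
      unfold eQ
      simp only [mul_zero, zero_add]
      rwa [Ne, stdAddChar_eq_one_iff]
    rw [norm_mul]
    refine mul_le_mul_of_nonneg_left ?_ (norm_nonneg _)
    have h1 := norm_hyperbolaSum_le (Q := Q) (W := q₁ * q₂) (a := a) hW (k + u')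
    refine h1.trans ?_
    rw [hB, ← hg]
    have hdvd := gcd_freq_dvd (Q := Q) hN₁.symm hN₂.symm (k := k) (u := u) hk₁ hk₂
    have hle : ((Nat.gcd (Nat.gcd (k + u').1.val (k + u').2.val) Q : ℕ) : ℝ) ≤ (D : ℝ) := by
      have hdvd' : Nat.gcd (Nat.gcd (k + u').1.val (k + u').2.val) Q ∣ D := by
        rw [hD]; exact hdvd
      exact_mod_cast Nat.le_of_dvd hDpos hdvd'
    gcongr
  -- Step 4: the `ℓ¹` bound for `Ĝ` and the assembly
  have hl1 : ∑ k : ZMod Q × ZMod Q, ‖coeff2 G k‖ ≤ Real.sqrt ((N₁ : ℝ) * N₂) :=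
    sum_norm_coeff2_le hG1 hN₁Q hN₂Q hGp₁ hGp₂
  have hB0 : 0 ≤ B := by
    rw [hB]
    exact mul_nonneg (mul_nonneg (mul_nonneg (Nat.cast_nonneg _) (Nat.cast_nonneg _))
      (Real.sqrt_nonneg _)) (Real.sqrt_nonneg _)
  have hq₁R : (0 : ℝ) < q₁ := by exact_mod_cast Nat.pos_of_ne_zero hq₁0
  have hq₂R : (0 : ℝ) < q₂ := by exact_mod_cast Nat.pos_of_ne_zero hq₂0
  rw [hstep1, hstep2, norm_div, norm_mul, Complex.norm_natCast, Complex.norm_natCast]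
  -- numeric identity `√(N₁N₂) √D = q₀ √q₀ √(u,Q)`
  have hND : Real.sqrt ((N₁ : ℝ) * N₂) * Real.sqrt D =
      (q₀ : ℝ) * Real.sqrt q₀ * Real.sqrt (Nat.gcd (Nat.gcd u.1.val u.2.val) Q) := by
    have hnat : N₁ * N₂ * (q₀ * q₁ * q₂) = q₀ * q₀ * q₀ := by
      calc N₁ * N₂ * (q₀ * q₁ * q₂) = q₀ * (q₁ * N₁) * (q₂ * N₂) := by ring
        _ = q₀ * q₀ * q₀ := by rw [← hN₁, ← hN₂]
    have hq₀R : (0 : ℝ) ≤ q₀ := Nat.cast_nonneg _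
    rw [← Real.sqrt_mul (by positivity), hD]
    push_cast
    rw [show (N₁ : ℝ) * N₂ * ((q₀ : ℝ) * q₁ * q₂ * (Nat.gcd (Nat.gcd u.1.val u.2.val) Q : ℕ)) =
      ((q₀ : ℝ) * q₀) * ((q₀ : ℝ) * (Nat.gcd (Nat.gcd u.1.val u.2.val) Q : ℕ)) by
        have := congrArg (fun n : ℕ => (n : ℝ)) hnat
        push_cast at this
        linear_combination ((Nat.gcd (Nat.gcd u.1.val u.2.val) Q : ℕ) : ℝ) * this]
    rw [Real.sqrt_mul (mul_nonneg hq₀R hq₀R), Real.sqrt_mul_self hq₀R, Real.sqrt_mul hq₀R]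
    ring
  calc ‖∑ k : ZMod Q × ZMod Q, coeff2 G k * ∑ m : ZMod Q × ZMod Q,
          (if ((q₁ * q₂ : ℕ) : ZMod Q) * m.1 * m.2 = a then eQ (k + u') m else 0)‖ / ((q₁ : ℝ) * q₂)
      ≤ (∑ k : ZMod Q × ZMod Q, ‖coeff2 G k * ∑ m : ZMod Q × ZMod Q,
          (if ((q₁ * q₂ : ℕ) : ZMod Q) * m.1 * m.2 = a then eQ (k + u') m else 0)‖) / ((q₁ : ℝ) * q₂) := by
        gcongr
        exact norm_sum_le _ _
    _ ≤ (∑ k : ZMod Q × ZMod Q, ‖coeff2 G k‖ * B) / ((q₁ : ℝ) * q₂) := by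
        gcongr with k
        exact hk k
    _ = (∑ k : ZMod Q × ZMod Q, ‖coeff2 G k‖) * B / ((q₁ : ℝ) * q₂) := by rw [Finset.sum_mul]
    _ ≤ Real.sqrt ((N₁ : ℝ) * N₂) * B / ((q₁ : ℝ) * q₂) := by gcongr
    _ ≤ Real.sqrt ((N₁ : ℝ) * N₂) * (((q₁ : ℝ) * q₂) * (Nat.divisors Q).card * Real.sqrt Q * Real.sqrt D) /
          ((q₁ : ℝ) * q₂) := by
        rw [hB]
        gcongr
    _ = Real.sqrt ((N₁ : ℝ) * N₂) * Real.sqrt D * (Nat.divisors Q).card * Real.sqrt Q := by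
        rw [div_eq_iff (mul_ne_zero hq₁R.ne' hq₂R.ne')]
        ring
    _ = (q₀ : ℝ) * Real.sqrt q₀ * (Nat.divisors Q).card * Real.sqrt Q *
          Real.sqrt (Nat.gcd (Nat.gcd u.1.val u.2.val) Q) := by
        rw [hND]
        ring


/-- `gcd((n + q₀).val, q₀) = gcd(n.val, q₀)` in `ℤ/Qℤ` for `q₀ ∣ Q`: the class of `n` is
`q₀`-periodic. [folklore] -/
theorem gcd_val_add_natCast {q₀ : ℕ} (hq₀ : q₀ ∣ Q) (n : ZMod Q) :
    Nat.gcd (n + (q₀ : ZMod Q)).val q₀ = Nat.gcd n.val q₀ := by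
  refine Nat.ModEq.gcd_eq ?_
  have h1 : (n + (q₀ : ZMod Q)).val ≡ n.val + (q₀ : ZMod Q).val [MOD q₀] := by
    rw [ZMod.val_add]
    exact (Nat.mod_modEq _ _).of_dvd hq₀
  have h2 : (q₀ : ZMod Q).val ≡ 0 [MOD q₀] := by
    rw [ZMod.val_natCast]
    exact ((Nat.mod_modEq q₀ Q).of_dvd hq₀).trans (Nat.modEq_zero_iff_dvd.mpr dvd_rfl)
  simpa using h1.trans (h2.add_left n.val)

/-- **Tao–Teräväinen 2022, Lemma 3.8 (Fourier coefficients on a hyperbola).** Let `Q ≥ 1`, let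
`q₀ ∣ Q` with `(a, Q) ∣ q₀`, and let `f : (ℤ/Qℤ)² → ℂ` be `1`-bounded with period `q₀` in each
variable. Then for all `u₁, u₂`,
`|𝔼_{n₁,n₂ ∈ ℤ/Qℤ} f(n₁,n₂) 1_{n₁n₂ = a} e_Q(u₁n₁ + u₂n₂)| ≤ τ(q₀)² q₀^{3/2} τ(Q) Q^{-3/2} (u₁,u₂,Q)^{1/2}`
(here `q₀^{3/2} = q₀ √q₀`, `Q^{-3/2} = 1/(Q √Q)`, `(u₁,u₂,Q) = gcd(gcd(u₁.val, u₂.val), Q)`).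
Proof as printed: at most `τ(q₀)²` classes `((n₁,q₀),(n₂,q₀)) = (q₁,q₂)`, each bounded by
(3.18) (`norm_hyperbolaSum_class_le`). [cite: TaoTeravainen2021, Lemma 3.8] -/
theorem norm_hyperbolaCoeff_le {q₀ : ℕ} (hq₀ : q₀ ∣ Q) {a : ZMod Q} (ha : Nat.gcd a.val Q ∣ q₀)
    {f : ZMod Q × ZMod Q → ℂ} (hf1 : ∀ n, ‖f n‖ ≤ 1)
    (hfp₁ : ∀ n, f (n + ((q₀ : ZMod Q), 0)) = f n) (hfp₂ : ∀ n, f (n + (0, (q₀ : ZMod Q))) = f n)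
    (u : ZMod Q × ZMod Q) :
    ‖hyperbolaCoeff f a u‖ ≤ ((Nat.divisors q₀).card : ℝ) ^ 2 * ((q₀ : ℝ) * Real.sqrt q₀) *
      (Nat.divisors Q).card * Real.sqrt (Nat.gcd (Nat.gcd u.1.val u.2.val) Q) /
        ((Q : ℝ) * Real.sqrt Q) := by
  classical
  have hQ0 : Q ≠ 0 := NeZero.ne Q
  have hQpos : (0 : ℝ) < Q := by exact_mod_cast Nat.pos_of_ne_zero hQ0
  have hq₀0 : q₀ ≠ 0 := by rintro rfl; exact hQ0 (zero_dvd_iff.mp hq₀)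
  -- the classes
  set C : Finset (ℕ × ℕ) := Nat.divisors q₀ ×ˢ Nat.divisors q₀ with hC
  set fc : ℕ × ℕ → ZMod Q × ZMod Q → ℂ := fun c n =>
    if Nat.gcd n.1.val q₀ = c.1 ∧ Nat.gcd n.2.val q₀ = c.2 then f n else 0 with hfc
  have hdecomp : ∀ n, f n = ∑ c ∈ C, fc c n := by
    intro n
    have hmem : (Nat.gcd n.1.val q₀, Nat.gcd n.2.val q₀) ∈ C := by
      rw [hC, Finset.mem_product, Nat.mem_divisors, Nat.mem_divisors]
      exact ⟨⟨Nat.gcd_dvd_right _ _, hq₀0⟩, ⟨Nat.gcd_dvd_right _ _, hq₀0⟩⟩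
    have heq : ∀ c : ℕ × ℕ, (Nat.gcd n.1.val q₀ = c.1 ∧ Nat.gcd n.2.val q₀ = c.2) ↔
        (Nat.gcd n.1.val q₀, Nat.gcd n.2.val q₀) = c := by
      intro c
      rw [Prod.ext_iff]
    simp only [hfc, heq]
    rw [Finset.sum_ite_eq C (Nat.gcd n.1.val q₀, Nat.gcd n.2.val q₀) (fun _ => f n), if_pos hmem]
  -- additivity of the hyperbola sum
  set S : (ZMod Q × ZMod Q → ℂ) → ℂ := fun F =>
    ∑ n : ZMod Q × ZMod Q, (if n.1 * n.2 = a then F n * eQ u n else 0) with hS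
  have hSsum : S f = ∑ c ∈ C, S (fc c) := by
    simp only [hS]
    rw [Finset.sum_comm]
    refine Finset.sum_congr rfl fun n _ => ?_
    split_ifs with h
    · rw [hdecomp n, Finset.sum_mul]
    · rw [Finset.sum_const_zero]
  -- each class obeys (3.18)
  have hclass : ∀ c ∈ C, ‖S (fc c)‖ ≤ (q₀ : ℝ) * Real.sqrt q₀ * (Nat.divisors Q).card * Real.sqrt Q *
      Real.sqrt (Nat.gcd (Nat.gcd u.1.val u.2.val) Q) := by
    intro c hc
    rw [hC, Finset.mem_product, Nat.mem_divisors, Nat.mem_divisors] at hc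
    refine norm_hyperbolaSum_class_le hq₀ ha hc.1.1 hc.2.1 (f := fc c) ?_ ?_ ?_ ?_ u
    · intro n
      simp only [hfc]
      split_ifs
      · exact hf1 n
      · rw [norm_zero]; exact zero_le_one
    · intro n
      simp only [hfc, Prod.fst_add, Prod.snd_add, add_zero, gcd_val_add_natCast hq₀, hfp₁ n]
    · intro n
      simp only [hfc, Prod.fst_add, Prod.snd_add, add_zero, gcd_val_add_natCast hq₀, hfp₂ n]
    · intro n hn
      simp only [hfc] at hn
      by_contra hne
      exact hn (if_neg hne)
  -- assemble
  have hcard : (C.card : ℝ) = ((Nat.divisors q₀).card : ℝ) ^ 2 := by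
    rw [hC, Finset.card_product, Nat.cast_mul, sq]
  unfold hyperbolaCoeff
  rw [norm_div, norm_pow, Complex.norm_natCast]
  change ‖S f‖ / (Q : ℝ) ^ 2 ≤ _
  rw [hSsum, div_le_div_iff₀ (by positivity) (by positivity)]
  calc ‖∑ c ∈ C, S (fc c)‖ * ((Q : ℝ) * Real.sqrt Q)
      ≤ (∑ c ∈ C, ‖S (fc c)‖) * ((Q : ℝ) * Real.sqrt Q) := by
        gcongr
        exact norm_sum_le _ _
    _ ≤ (∑ _c ∈ C, (q₀ : ℝ) * Real.sqrt q₀ * (Nat.divisors Q).card * Real.sqrt Q *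
          Real.sqrt (Nat.gcd (Nat.gcd u.1.val u.2.val) Q)) * ((Q : ℝ) * Real.sqrt Q) := by
        gcongr with c hc
        exact hclass c hc
    _ = ((Nat.divisors q₀).card : ℝ) ^ 2 * ((q₀ : ℝ) * Real.sqrt q₀) * (Nat.divisors Q).card *
          Real.sqrt (Nat.gcd (Nat.gcd u.1.val u.2.val) Q) * ((Q : ℝ) * (Real.sqrt Q * Real.sqrt Q)) := by
        rw [Finset.sum_const, nsmul_eq_mul, hcard]
        ring
    _ = ((Nat.divisors q₀).card : ℝ) ^ 2 * ((q₀ : ℝ) * Real.sqrt q₀) * (Nat.divisors Q).card *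
          Real.sqrt (Nat.gcd (Nat.gcd u.1.val u.2.val) Q) * (Q : ℝ) ^ 2 := by
        rw [Real.mul_self_sqrt hQpos.le, sq, sq]

end TaoTeravainen

end Literature.Barriers.Parity
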